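import Literature.NumberTheory.LFunctions.WeilFinitePrimeSliver
import HarnessLib

/-!
# RiemannHypothesis / GroundBarta — rung 4 (`EvenWinsBeyondArch`), `c = 83/100`: the constants shared by the EVEN and the ODD last files

Helper file (`--supports stmt-RiemannHypothesis-18085`), RH-free, no named facts.  Prover A g21 (unit `sr-gb-rung-a`).

The three-zone weighted Gram assemblies of BOTH sector blocks at `c = 83/100` (`…DeflationN83ELastA` / `…N83ELast` for the even block,
`…DeflationN83OLastA` / `…N83OLast` for the odd block) use the same zone thresholds `y₄ = 12·c/m = 83/150` and `y₅ = 16·c/m = 166/225`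
(`m = 18` sub-intervals) and the same rational majorants `κ₄ = 433217/1250000 ≥ (log 2)/2`, `κ₅ = 3598813/5000000 ≥ log 5/√5` of the two
prime weights.  This module states them ONCE, together with the five elementary inequalities and the two measurability facts both
assemblies consume, so that neither sector file restates a declaration of the other (sector twins with definitionally equal statements
are one declaration for the tree).

Contents: `n83Lk4`, `n83Lk5`, `n83Ly4`, `n83Ly5`; `n83L_hy4` / `n83L_hy5` (the thresholds ARE `12·c/m`, `16·c/m` — literal form,
definitionally the R-layers' `ro83c / ro83m` and `re83c / re83m` forms since all four window constants unfold to `83/100` and `18`);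
`n83L_hk4`, `n83L_hk5`, `n83L_hy4le`, `n83L_hy5le`, `n83L_hy45`; `n83L_measE4`, `n83L_measE5`.
-/

set_option linter.dupNamespace false

namespace Summit.RiemannHypothesis.RiemannHypothesis.Theorems.EvenWinsBeyondArch

open Literature.NumberTheory.LFunctions

/-- `κ₄ = 433217/1250000`, a rational majorant of the prime weight `(log 2)/2 = log 4/√4`. -/
def n83Lk4 : ℚ := ((433217 : ℚ)/1250000)

/-- `κ₅ = 3598813/5000000`, a rational majorant of the prime weight `log 5/√5`. -/
def n83Lk5 : ℚ := ((3598813 : ℚ)/5000000)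

/-- the middle-zone threshold `y₄ = 12·(83/100)/18 = 83/150`. -/
def n83Ly4 : ℚ := ((83 : ℚ)/150)

/-- the outer-zone threshold `y₅ = 16·(83/100)/18 = 166/225`. -/
def n83Ly5 : ℚ := ((166 : ℚ)/225)

/-- `y₄` is the R-layer's zone edge `n₁·c/m` with `n₁ = 12`, `c = 83/100`, `m = 18` (literal form). -/
theorem n83L_hy4 : ((n83Ly4 : ℚ) : ℝ) = ((((12 : ℚ) * (((83 : ℚ)/100) / ((18 : ℕ) : ℚ)) : ℚ)) : ℝ) := by norm_num [n83Ly4]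

/-- `y₅` is the R-layer's zone edge `n₂·c/m` with `n₂ = 16`, `c = 83/100`, `m = 18` (literal form). -/
theorem n83L_hy5 : ((n83Ly5 : ℚ) : ℝ) = ((((16 : ℚ) * (((83 : ℚ)/100) / ((18 : ℕ) : ℚ)) : ℚ)) : ℝ) := by norm_num [n83Ly5]

/-- `(log 2)/2 ≤ κ₄` (Mathlib's `Real.log_two_lt_d9`). -/
theorem n83L_hk4 : Real.log 2 / 2 ≤ ((n83Lk4 : ℚ) : ℝ) := by
  have := Real.log_two_lt_d9
  unfold n83Lk4; push_cast; linarith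

/-- `log 5/√5 ≤ κ₅` (`Literature…log_five_div_sqrt_five_le`: `≤ 0.7197626`). -/
theorem n83L_hk5 : Real.log 5 / Real.sqrt 5 ≤ ((n83Lk5 : ℚ) : ℝ) := by
  have h := log_five_div_sqrt_five_le
  unfold n83Lk5; push_cast; norm_num at h ⊢; exact h

/-- `y₄ ≤ log 4 − 83/100`: the middle zone starts beyond the reach of the `n = 4` shift inside the window. -/
theorem n83L_hy4le : ((n83Ly4 : ℚ) : ℝ) ≤ Real.log 4 - 83 / 100 := by
  have h2 := Real.log_two_gt_d9
  have h4 : Real.log 4 = 2 * Real.log 2 := by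
    rw [show (4 : ℝ) = 2 ^ 2 by norm_num, Real.log_pow]; push_cast; ring
  unfold n83Ly4; push_cast; rw [h4]; linarith

/-- `y₅ ≤ log 5 − 83/100` (via `log 5 ≥ 2 log 2 + (1 − 4/5)`). -/
theorem n83L_hy5le : ((n83Ly5 : ℚ) : ℝ) ≤ Real.log 5 - 83 / 100 := by
  have h2 := Real.log_two_gt_d9
  have h4 : Real.log 4 = 2 * Real.log 2 := by
    rw [show (4 : ℝ) = 2 ^ 2 by norm_num, Real.log_pow]; push_cast; ring
  have h54 : 1 - (5 / 4 : ℝ)⁻¹ ≤ Real.log (5 / 4) := Real.one_sub_inv_le_log_of_pos (by norm_num)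
  have h5 : Real.log 5 = Real.log 4 + Real.log (5 / 4) := by
    rw [← Real.log_mul (by norm_num) (by norm_num)]; norm_num
  unfold n83Ly5; push_cast; rw [h5, h4]; norm_num at h54 ⊢; linarith

/-- `y₄ ≤ y₅`. -/
theorem n83L_hy45 : ((n83Ly4 : ℚ) : ℝ) ≤ ((n83Ly5 : ℚ) : ℝ) := by norm_num [n83Ly4, n83Ly5]

/-- The outer zone `{y₅ ≤ |u|}` is measurable. -/
theorem n83L_measE5 : MeasurableSet {u : ℝ | ((n83Ly5 : ℚ) : ℝ) ≤ |u|} :=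
  measurableSet_le measurable_const continuous_abs.measurable

/-- The middle zone `{y₄ ≤ |u|}` is measurable. -/
theorem n83L_measE4 : MeasurableSet {u : ℝ | ((n83Ly4 : ℚ) : ℝ) ≤ |u|} :=
  measurableSet_le measurable_const continuous_abs.measurable

end Summit.RiemannHypothesis.RiemannHypothesis.Theorems.EvenWinsBeyondArch
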